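import Mathlib
import Summits.ValiantsHypothesis.ValiantsHypothesis.Theorems.SoloInformedProductTrick

/-!
# The toric step: freeness ⟹ bounded-degree algebraic independence of the target monomials

Quadspan note, Lemma 7.84.0 and its corollary (sessions s25/s26).  In the curve model
`Ω = AlgebraicClosure (Frac ℂ[z])`, consider the point `x = (κ_t · z^{e_t})_{t < n}` with nonzero
scalars `κ_t`.  A polynomial `P ∈ ℂ[X_1, …, X_n]` evaluates at `x` to
`∑_d (coeff_d P · ∏_t κ_t^{d_t}) · z^{⟨e, d⟩}`, `⟨e, d⟩ = ∑_t e_t d_t` (the *weight* of the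
monomial `d`).  Since the powers of `z` are linearly independent
(`solo_linearIndependent_soloZ_pow`), `P(x) = 0` with `P ≠ 0` forces two *distinct* monomials of `P`
to have the same weight (`soloInformed_toricStep`): a relation among scaled powers of `z` is never
"honest", it collapses a binomial `X^d - λ X^{d'}` with `⟨e, d - d'⟩ = 0`.

Consequently (`soloInformed_aeval_ne_zero_of_free`): if `E ⊂ ℕ` is `(K, h)`-free in the sense of
`SoloQuadSpanBound.bound` (no nontrivial integer relation with `≤ K` nonzero coefficients of height
`≤ h`), then for any `n ≤ K` distinct exponents `e_t ∈ E`, any nonzero `κ_t`, and any nonzero `P`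
whose monomials have all exponents `≤ h`, `P(κ_1 z^{e_1}, …, κ_n z^{e_n}) ≠ 0`: the target
monomials of a free realisation are algebraically independent "up to order `K` and height `h`".
This is the kernel core of the toric-rigidity / local-linearity statements of the note (§7.84–7.87):
all the Segre-type syzygies that a quadratic parametrisation `z^e = Γ_e(b)` produces must be
absorbed by the non-target part of the span.
-/

noncomputable section

namespace Summit.ValiantsHypothesis.ValiantsHypothesis.Theorems

open Finset MvPolynomial

/-- The weight `⟨e, d⟩ = ∑_t e_t · d_t` of an exponent vector `d` against the exponents `e`. -/
def soloWeight {n : ℕ} (e : Fin n → ℕ) (d : Fin n →₀ ℕ) : ℕ := ∑ t, e t * d t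

/-- Evaluation of `P` at the scaled monomial point `(κ_t z^{e_t})_t`, expanded in powers of `z`. -/
theorem soloInformed_aeval_scaledPow_eq {n : ℕ} (e : Fin n → ℕ) (κ : Fin n → ℂ)
    (P : MvPolynomial (Fin n) ℂ) :
    aeval (fun t => algebraMap ℂ SoloΩ (κ t) * soloZ ^ e t) P =
      ∑ d ∈ P.support, (coeff d P * ∏ t, κ t ^ d t) • soloZ ^ soloWeight e d := by
  rw [MvPolynomial.aeval_def, MvPolynomial.eval₂_eq']
  refine Finset.sum_congr rfl fun d _ => ?_
  have h1 : (∏ i, (algebraMap ℂ SoloΩ (κ i) * soloZ ^ e i) ^ d i) =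
      algebraMap ℂ SoloΩ (∏ t, κ t ^ d t) * soloZ ^ soloWeight e d := by
    rw [map_prod, soloWeight, ← Finset.prod_pow_eq_pow_sum, ← Finset.prod_mul_distrib]
    refine Finset.prod_congr rfl fun i _ => ?_
    rw [mul_pow, map_pow, pow_mul]
  rw [h1, Algebra.smul_def, map_mul, mul_assoc]

/-- **Toric step** (quadspan note, Lemma 7.84.0).  If a nonzero polynomial `P` vanishes at the
point `(κ_t z^{e_t})_t` of `Ω` (all `κ_t ≠ 0`), then two distinct monomials of `P` have the same
weight `∑_t e_t d_t`. -/
theorem soloInformed_toricStep {n : ℕ} (e : Fin n → ℕ) (κ : Fin n → ℂ) (hκ : ∀ t, κ t ≠ 0)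
    (P : MvPolynomial (Fin n) ℂ) (hP : P ≠ 0)
    (h0 : aeval (fun t => algebraMap ℂ SoloΩ (κ t) * soloZ ^ e t) P = 0) :
    ∃ d ∈ P.support, ∃ d' ∈ P.support, d ≠ d' ∧ soloWeight e d = soloWeight e d' := by
  classical
  by_contra hcon
  push Not at hcon
  -- the coefficients of the scaled monomials are nonzero on the support
  have hc : ∀ d ∈ P.support, coeff d P * ∏ t, κ t ^ d t ≠ 0 := fun d hd =>
    mul_ne_zero (MvPolynomial.mem_support_iff.mp hd)
      (Finset.prod_ne_zero_iff.mpr fun t _ => pow_ne_zero _ (hκ t))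
  -- regroup the vanishing sum by weight
  have hre : ∑ a ∈ P.support.image (soloWeight e),
      (∑ d ∈ P.support.filter (fun d => soloWeight e d = a), coeff d P * ∏ t, κ t ^ d t) •
        soloZ ^ a =
      ∑ d ∈ P.support, (coeff d P * ∏ t, κ t ^ d t) • soloZ ^ soloWeight e d := by
    refine Finset.sum_image' _ (fun i _ => ?_)
    rw [Finset.sum_smul]
    exact Finset.sum_congr rfl (fun j hj => by rw [(Finset.mem_filter.mp hj).2])
  have hsum : ∑ a ∈ P.support.image (soloWeight e),
      (∑ d ∈ P.support.filter (fun d => soloWeight e d = a), coeff d P * ∏ t, κ t ^ d t) •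
        soloZ ^ a = 0 := by
    rw [hre]
    exact (soloInformed_aeval_scaledPow_eq e κ P).symm.trans h0
  obtain ⟨d₀, hd₀⟩ := MvPolynomial.ne_zero_iff.mp hP
  have hd₀s : d₀ ∈ P.support := MvPolynomial.mem_support_iff.mpr hd₀
  -- linear independence of the powers of `z` kills every weight class
  have hz : (∑ d ∈ P.support.filter (fun d => soloWeight e d = soloWeight e d₀),
      coeff d P * ∏ t, κ t ^ d t) = 0 :=
    linearIndependent_iff'.mp solo_linearIndependent_soloZ_pow _ _ hsum _
      (Finset.mem_image_of_mem _ hd₀s)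
  -- but (no two monomials sharing a weight) the class of `d₀` is `{d₀}`
  have hfib : (∑ d ∈ P.support.filter (fun d => soloWeight e d = soloWeight e d₀),
      coeff d P * ∏ t, κ t ^ d t) = coeff d₀ P * ∏ t, κ t ^ d₀ t := by
    refine Finset.sum_eq_single_of_mem d₀ ?_ ?_
    · exact Finset.mem_filter.mpr ⟨hd₀s, rfl⟩
    · intro d hd hne
      obtain ⟨hds, hw⟩ := Finset.mem_filter.mp hd
      exact absurd hw (hcon d hds d₀ hd₀s hne)
  exact hc d₀ hd₀s (hfib.symm.trans hz)

/-- **Freeness ⟹ bounded-degree algebraic independence of the target monomials**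
(quadspan note, Cor. 7.84.1).  Let `E ⊂ ℕ` be `(K, h)`-free in the sense of
`SoloQuadSpanBound.bound`, let `e : Fin n → E` be injective with `n ≤ K`, let `κ_t ≠ 0`, and let
`P ≠ 0` be a polynomial all of whose monomials have exponents `≤ h` in every variable.  Then
`P(κ_1 z^{e_1}, …, κ_n z^{e_n}) ≠ 0` in `Ω`. -/
theorem soloInformed_aeval_ne_zero_of_free {K h n : ℕ} (E : Finset ℕ)
    (hfree : ∀ c : ℕ → ℤ, (E.filter fun x => c x ≠ 0).card ≤ K → (∀ x, |c x| ≤ h) →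
      (∑ x ∈ E, c x * (x : ℤ)) = 0 → ∀ x ∈ E, c x = 0)
    (e : Fin n → ℕ) (he : Function.Injective e) (heE : ∀ t, e t ∈ E) (hn : n ≤ K)
    (κ : Fin n → ℂ) (hκ : ∀ t, κ t ≠ 0) (P : MvPolynomial (Fin n) ℂ) (hP : P ≠ 0)
    (hdeg : ∀ d ∈ P.support, ∀ t, d t ≤ h) :
    aeval (fun t => algebraMap ℂ SoloΩ (κ t) * soloZ ^ e t) P ≠ 0 := by
  classical
  intro h0
  obtain ⟨d, hd, d', hd', hne, hw⟩ := soloInformed_toricStep e κ hκ P hP h0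
  -- the coefficient vector of the collapsed binomial, transported to `ℕ ⊇ E`
  set c : ℕ → ℤ := Function.extend e (fun t => ((d t : ℤ) - (d' t : ℤ))) 0 with hcdef
  have hce : ∀ t, c (e t) = (d t : ℤ) - (d' t : ℤ) := fun t => by
    rw [hcdef, he.extend_apply]
  have hc0 : ∀ x, (¬ ∃ t, e t = x) → c x = 0 := fun x hx => by
    rw [hcdef, Function.extend_apply' _ _ _ hx, Pi.zero_apply]
  -- at most `n ≤ K` nonzero coefficients
  have hsub : (E.filter fun x => c x ≠ 0) ⊆ Finset.univ.image e := by
    intro x hx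
    have hx2 := (Finset.mem_filter.mp hx).2
    by_contra hxi
    exact hx2 (hc0 x (fun ⟨t, ht⟩ => hxi (Finset.mem_image.mpr ⟨t, Finset.mem_univ _, ht⟩)))
  have hcard : (E.filter fun x => c x ≠ 0).card ≤ K :=
    calc (E.filter fun x => c x ≠ 0).card ≤ (Finset.univ.image e).card := Finset.card_le_card hsub
      _ ≤ (Finset.univ : Finset (Fin n)).card := Finset.card_image_le
      _ = n := Finset.card_fin n
      _ ≤ K := hn
  -- heights `≤ h`
  have hheight : ∀ x, |c x| ≤ (h : ℤ) := by
    intro x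
    by_cases hx : ∃ t, e t = x
    · obtain ⟨t, rfl⟩ := hx
      rw [hce]
      have h1 : d t ≤ h := hdeg d hd t
      have h2 : d' t ≤ h := hdeg d' hd' t
      rw [abs_le]
      constructor <;> omega
    · rw [hc0 x hx, abs_zero]
      positivity
  -- it is a relation on `E`
  have hrel : (∑ x ∈ E, c x * (x : ℤ)) = 0 := by
    have himg : Finset.univ.image e ⊆ E := by
      intro x hx
      obtain ⟨t, _, rfl⟩ := Finset.mem_image.mp hx
      exact heE t
    rw [← Finset.sum_subset himg ?_]
    · rw [Finset.sum_image he.injOn]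
      simp_rw [hce, sub_mul, Finset.sum_sub_distrib]
      rw [sub_eq_zero]
      have hw' := congrArg (Nat.cast : ℕ → ℤ) hw
      push_cast [soloWeight] at hw'
      simpa [mul_comm] using hw'
    · intro x _ hxi
      rw [hc0 x (fun ⟨t, ht⟩ => hxi (Finset.mem_image.mpr ⟨t, Finset.mem_univ _, ht⟩)), zero_mul]
  -- freeness makes it trivial, i.e. `d = d'`
  have hcz := hfree c hcard hheight hrel
  apply hne
  ext t
  have := hcz (e t) (heE t)
  rw [hce] at this
  omega

end Summit.ValiantsHypothesis.ValiantsHypothesis.Theorems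

end
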